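import Summits.BirchSwinnertonDyer.BirchSwinnertonDyer.Theses.SylvesterTwoHeegnerIndex
import Summits.BirchSwinnertonDyer.Rank1Residual.X12.CubeSumSylvesterAtTwo
import Summits.BirchSwinnertonDyer.Rank1Residual.Additive.StrictSelmerIndex
import HarnessLib

/-!
# Route `SylvesterTwoHeegnerIndex` (rung K7t), crux `HeegnerIndexUpperAtTwoHSY` (item 19229):
# the birth skeleton's composition with its M-stub DISCHARGED modulo Hu–Shu–Yin 2019 —
# `HeegnerIndexUpperAtTwoHSY ⟸ (HSY Thm 1.3) ∧ (E_p(ℚ₂)[2] = 0 on the class) ∧ stub_strictSelmerUpperAtTwo`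

HONEST FRAMING (cell «bsd-cm», `run/shared/lean/pub/bsd-cm/`, D-0033 tranche 1a; D-0074 seat
`bsd-cm-k7t-c2`, item stmt-BirchSwinnertonDyer-19229): the planner's BC3 birth skeleton
(`HeegnerIndexHalvesAtTwo_birth_pub.lean`, a61a9288a4220307) splits the crux through the STRICT
`2^∞`-Selmer group `Sel_str(E_p/ℚ)[2^∞]` (`Additive.strictSelmerPInfty W 2`):
`HeegnerIndexUpperAtTwoHSY ⟸ stub_strictSelmerUpperAtTwo` (the Euler-system bound
`log₂ #Sel_str ≤ ν₂(P₀) + ord₂ 𝔮` — XL, the OPEN content) `∧ stub_shaLeStrictSelmerAtTwo` (descent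
bookkeeping: a generator `P₀` of `E_p(ℚ)` modulo torsion with its exact `2`-adic level `ν₂` in
`E_p(ℚ₂)`, `E_p(ℚ₂)[2] = 0`, and `log₂ #Ш + ν₂ ≤ log₂ #Sel_str`). FINDING: the M-stub is NOT provable as
registered — it is fact-free yet asserts `rank E_p(ℚ) = 1` (Sylvester's conjecture on the class; in
print Dasgupta–Voight / Hu–Shu–Yin Thm 1.3, a NAMED FACT of the tree) and needs `Ш(E_p)[2^∞]` finite.
This file proves the CORRECTED M-stub and the skeleton's composition, sorry-free:

* `exists_generator_level_of_thm14` — for every member `W` of 𝒞_HSY with `W(ℚ₂)[2] = 0`: a generator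
  `P₀` of `W(ℚ)` modulo torsion, its exact `2`-divisibility level `n` in `W(ℚ₂)`, `Ш(W)` finite, and the
  PROVED index identity `ord₂ #Sel_str(W)[2^∞] = n + ord₂ #Ш(W)`
  (`Additive.StrictSha.padicValNat_card_strictSelmerPInfty_eq`, Greenberg LNM 1716 §2), from
  Hu–Shu–Yin 2019 Thm 1.3 (`thm14_threePart_product`: `rank W(ℚ) = 1`, `Ш(W)` finite).
* `stub_shaLeStrictSelmerAtTwo_of_thm14` — the registered M-stub's signature VERBATIM, under the two
  displayed hypotheses `hHSY` and `h2` (`W(ℚ₂)[2] = 0` for every member: `x³ = 54·c₆(W)` has no root in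
  `ℚ₂` since `ord₂(54 c₆) ≡ 1 (mod 3)` — claimed by the sibling seat k7t-c3, imported when it lands).
* **`heegnerIndexUpperAtTwoHSY_of_strictSelmerUpper`** — `hHSY → h2 → stub_strictSelmerUpperAtTwo → crux`:
  modulo Hu–Shu–Yin Thm 1.3 (a conjunct of the route's support item 19231) and the `2`-torsion lemma,
  the crux IS the strict-Selmer Euler-system bound at `2` (the skeleton's XL stub), nothing else.

Nothing asserted; the crux, the XL stub and the class 𝒞_HSY at `2` (B14 / O12) stay OPEN; nothing booked.
References: [HuShuYin2019] Thm 1.3/1.4 (p. 3); [GreenbergLNM1716] §2 (pp. 62–63); [KuriharaPollack2007]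
§1.5; [SilvermanAEC2009] Prop. VII.6.3; [Kolyvagin1990] Thm A; parents `Additive/StrictSelmerIndex.lean`,
`X12/CubeSumFamilies.lean`, the birth skeleton (evidence on 19229/19230).
-/

set_option autoImplicit false
set_option linter.dupNamespace false

noncomputable section

open scoped Classical

open WeierstrassCurve NumberField Literature.NumberTheory.EllipticCurves
  Literature.NumberTheory.EllipticCurves.ModularForms
  Literature.NumberTheory.EllipticCurves.Rank1Residual
  Literature.NumberTheory.EllipticCurves.HuShuYin2019
  Summit.BirchSwinnertonDyer.Rank1Residual
  Summit.BirchSwinnertonDyer.Rank1Residual.P2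
  Summit.BirchSwinnertonDyer.Rank1Residual.Additive
  Summit.BirchSwinnertonDyer.BirchSwinnertonDyer.Theses.SylvesterTwoHeegnerIndex

namespace Summit.BirchSwinnertonDyer.BirchSwinnertonDyer.Theorems.SylvesterTwoUpper

/-! ## §1 The shared witness: generator, exact `2`-adic level, `Ш` finite, strict-Selmer index identity -/

/-- **Generator + level + index identity for a member of 𝒞_HSY** (shared by both halves' M-stubs).
For `p ≡ 4, 7 (mod 9)` prime with `3 ∉ 𝔽_p^{×3}`, `W` a globally minimal model of `E_p` with
`W(ℚ₂)[2] = 0` (`htors`): there are `P₀ ∈ W(ℚ)` of infinite order generating `W(ℚ)` modulo torsion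
and `n` with `2ⁿ ∣ P₀`, `2ⁿ⁺¹ ∤ P₀` in `W(ℚ₂)`; `Ш(W)` is finite; and
`ord₂ #Sel_str(W)[2^∞] = n + ord₂ #Ш(W)`. Inputs: Hu–Shu–Yin Thm 1.3 (`hHSY`: rank `1`, `Ш` finite —
the rank-zero partner `E_{3p²}` has a globally minimal model, `X12.CubeSumFamilies.exists_isGloballyMinimal_model`);
Mordell–Weil (`exists_generator_of_mordellWeilRank_eq_one`); the `ℤ₂`-valued logarithm on `W(ℚ₂)`
(`exists_addMonoidHom_padicInt_apply_eq_zero_iff`, AEC VII.6.3) for the level; the PROVED index theorem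
`StrictSha.padicValNat_card_strictSelmerPInfty_eq`; `ord₂ #Ш[2^∞] = ord₂ #Ш` for finite `Ш`.
[cite: HuShuYin2019, Thm. 1.3 (p. 3)] [cite: GreenbergLNM1716, §2 (pp. 62–63)]
[cite: SilvermanAEC2009, Prop. VII.6.3 and Thm. VIII.6.7] -/
theorem exists_generator_level_of_thm14 (hHSY : thm14_threePart_product)
    {p : ℕ} (hp : p.Prime) (h9 : p % 9 = 4 ∨ p % 9 = 7) (h3 : ¬ ∃ x : ZMod p, x ^ 3 = 3)
    (W : WeierstrassCurve ℚ) [W.IsElliptic] [W.IsGloballyMinimal]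
    (hW : ∃ C : VariableChange ℚ, C • W = cubeSumCurve (p : ℚ))
    (htors : ∀ Q : (W.baseChange ℚ_[2]).toAffine.Point, 2 • Q = 0 → Q = 0) :
    ∃ (P₀ : W.toAffine.Point) (n : ℕ), ¬ IsOfFinAddOrder P₀ ∧
      (∀ R : W.toAffine.Point, ∃ (m : ℤ) (T : W.toAffine.Point), IsOfFinAddOrder T ∧ R = m • P₀ + T) ∧
      (∃ Q : (W.baseChange ℚ_[2]).toAffine.Point, 2 ^ n • Q = W.toPadicPoint 2 P₀) ∧
      (∀ Q : (W.baseChange ℚ_[2]).toAffine.Point, 2 ^ (n + 1) • Q ≠ W.toPadicPoint 2 P₀) ∧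
      Finite W.sha ∧
      padicValNat 2 (Nat.card ↥(strictSelmerPInfty W 2)) = n + padicValNat 2 (Nat.card W.sha) := by
  haveI : Fact (2 : ℕ).Prime := ⟨Nat.prime_two⟩
  -- Hu–Shu–Yin Thm 1.3: rank one and `Ш` finite (feed a globally minimal model of the partner `E_{3p²}`)
  have hn : (3 * (p : ℚ) ^ 2) ≠ 0 :=
    mul_ne_zero (by norm_num) (pow_ne_zero _ (Nat.cast_ne_zero.mpr hp.ne_zero))
  haveI := X12.CubeSumFamilies.isElliptic_cubeSumCurve hn
  obtain ⟨A, _, _, CA, hA⟩ :=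
    X12.CubeSumFamilies.exists_isGloballyMinimal_model (cubeSumCurve (3 * (p : ℚ) ^ 2))
  obtain ⟨hrk, -, hfin, -⟩ := hHSY p hp h9 h3 A W hW ⟨CA, hA⟩
  haveI : Finite W.sha := hfin
  -- a generator modulo torsion
  obtain ⟨P₀, hP₀, hgen⟩ := exists_generator_of_mordellWeilRank_eq_one W hrk
  have hP₀' : ¬ IsOfFinAddOrder P₀ := by convert hP₀
  have hgen' : ∀ R : W.toAffine.Point, ∃ (m : ℤ) (T : W.toAffine.Point),
      IsOfFinAddOrder T ∧ R = m • P₀ + T := fun R => by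
    obtain ⟨a, t, ht, hR⟩ := hgen R
    exact ⟨a, t, by convert ht, by convert hR⟩
  -- its exact `2`-adic level in `W(ℚ₂)`
  obtain ⟨lam, hlam⟩ := exists_addMonoidHom_padicInt_apply_eq_zero_iff 2 (W.baseChange ℚ_[2])
  have hinj : Function.Injective (W.toPadicPoint 2) :=
    Affine.Point.map_injective (W' := W) (Algebra.ofId ℚ ℚ_[2])
  have hPp : ¬ IsOfFinAddOrder (W.toPadicPoint 2 P₀) := by
    intro h
    apply hP₀'
    obtain ⟨m, hm, hmP⟩ := isOfFinAddOrder_iff_nsmul_eq_zero.mp h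
    refine isOfFinAddOrder_iff_nsmul_eq_zero.mpr ⟨m, hm, hinj ?_⟩
    rw [map_nsmul, map_zero]
    exact hmP
  obtain ⟨n, hdiv, hndiv⟩ := StrictSha.exists_level_of_not_isOfFinAddOrder 2 lam hlam hPp
  -- the PROVED index identity, and `ord₂ #Ш[2^∞] = ord₂ #Ш`
  have hidx := StrictSha.padicValNat_card_strictSelmerPInfty_eq W 2 hP₀' hgen' htors hdiv hndiv
  rw [padicValNat_card_addPrimaryComponent 2] at hidx
  exact ⟨P₀, n, hP₀', hgen', hdiv, hndiv, hfin, hidx⟩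

/-! ## §2 The birth skeleton's M-stub `stub_shaLeStrictSelmerAtTwo`, CORRECTED (two displayed inputs) -/

/-- **`stub_shaLeStrictSelmerAtTwo` of the birth skeleton — its registered signature VERBATIM —
holds granted Hu–Shu–Yin 2019 Thm 1.3 (`hHSY`, rank `1` and `Ш` finite on 𝒞_HSY; a conjunct of the
route's support item `PublishedFactsTwo`) and `W(ℚ₂)[2] = 0` for every member (`h2`).** As REGISTERED
(fact-free) the stub asserts Sylvester's conjecture in the kernel and is not provable; this is the honest
form. The inequality is the equality of `exists_generator_level_of_thm14` read `≤`.
[cite: HuShuYin2019, Thm. 1.3 (p. 3)] [cite: GreenbergLNM1716, §2 (pp. 62–63)] -/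
theorem stub_shaLeStrictSelmerAtTwo_of_thm14 (hHSY : thm14_threePart_product)
    (h2 : ∀ (p : ℕ), p.Prime → (p % 9 = 4 ∨ p % 9 = 7) → (¬ ∃ x : ZMod p, x ^ 3 = 3) →
      ∀ (W : WeierstrassCurve ℚ) [W.IsElliptic] [W.IsGloballyMinimal],
        (∃ C : VariableChange ℚ, C • W = cubeSumCurve (p : ℚ)) →
          ∀ Q : (W.baseChange ℚ_[2]).toAffine.Point, 2 • Q = 0 → Q = 0) :
    ∀ (p : ℕ), p.Prime → (p % 9 = 4 ∨ p % 9 = 7) → (¬ ∃ x : ZMod p, x ^ 3 = 3) → ∀ (W : WeierstrassCurve ℚ) [W.IsElliptic] [W.IsGloballyMinimal], (∃ C : WeierstrassCurve.VariableChange ℚ, C • W = Literature.NumberTheory.EllipticCurves.HuShuYin2019.cubeSumCurve (p : ℚ)) → ∀ (N : ℕ) [NeZero N] (K : Type) [Field K] [NumberField K] (Dt : Literature.NumberTheory.EllipticCurves.ModularForms.ModularParametrizationData W N) (H : Literature.NumberTheory.EllipticCurves.HeegnerDatum N (NumberField.discr K)) (ι : K →+* ℂ) (P : (W.baseChange K).toAffine.Point)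 (Wd : WeierstrassCurve ℚ) [Wd.IsElliptic] [Wd.IsGloballyMinimal] (Cd : WeierstrassCurve.VariableChange ℚ) (k : ℕ), W.HasCM → W.analyticRank = 1 → Literature.NumberTheory.EllipticCurves.IsImaginaryQuadratic K → Literature.NumberTheory.EllipticCurves.SatisfiesHeegnerHypothesis N K → WeierstrassCurve.Affine.Point.map ι.toRatAlgHom P = Literature.NumberTheory.EllipticCurves.ModularForms.heegnerPointComplex Dt H → (W.quadraticTwist (NumberField.discr K : ℚ)).entireLFunction 1 ≠ 0 → Cd • W.quadraticTwist (NumberField.discr K : ℚ) = Wd → (k = 1 ∨ k = 2) → (k = 2 ↔ ∀ y : W.toAffine.Point, ∃ Q : (W.baseChange K).toAffine.Point, WeierstrassCurve.QuadraticDescent.incl K W y - (2 : ℤ) • Q ∈ AddCommGroup.torsion (W.baseChange K).toAffine.Point) → ∃ (P₀ : W.toAffine.Point) (n : ℕ), ¬ IsOfFinAddOrder P₀ ∧ (∀ R : W.toAffine.Point, ∃ (m : ℤ) (T : W.toAffine.Point), IsOfFinAddOrder T ∧ R = m • P₀ + T) ∧ (∀ Q : (W.baseChange ℚ_[2]).toAffine.Point,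 2 • Q = 0 → Q = 0) ∧ (∃ Q : (W.baseChange ℚ_[2]).toAffine.Point, 2 ^ n • Q = W.toPadicPoint 2 P₀) ∧ (∀ Q : (W.baseChange ℚ_[2]).toAffine.Point, 2 ^ (n + 1) • Q ≠ W.toPadicPoint 2 P₀) ∧ (padicValNat 2 (Nat.card W.sha) : ℤ) + (n : ℤ) ≤ (padicValNat 2 (Nat.card ↥(Summit.BirchSwinnertonDyer.Rank1Residual.Additive.strictSelmerPInfty W 2)) : ℤ) := by
  intro p hp h9 h3 W _ _ hW N _ K _ _ Dt H ι P Wd _ _ Cd k _hcm _hr _hK _hHN _hP _hLt _hWd _hk12 _hkiff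
  have htors := h2 p hp h9 h3 W hW
  obtain ⟨P₀, n, hP₀, hgen, hdiv, hndiv, -, hidx⟩ :=
    exists_generator_level_of_thm14 hHSY hp h9 h3 W hW htors
  refine ⟨P₀, n, hP₀, hgen, htors, hdiv, hndiv, ?_⟩
  rw [hidx]
  push_cast
  linarith

/-! ## §3 The skeleton's composition: crux ⟸ HSY Thm 1.3 ∧ (W(ℚ₂)[2] = 0) ∧ the XL stub -/

/-- **`HeegnerIndexUpperAtTwoHSY ⟸ (Hu–Shu–Yin Thm 1.3) ∧ (W(ℚ₂)[2] = 0 on 𝒞_HSY) ∧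
`stub_strictSelmerUpperAtTwo`.** The birth skeleton's `HeegnerIndexUpperAtTwoHSY_of` with its M-stub
replaced by `stub_shaLeStrictSelmerAtTwo_of_thm14`: the hypothesis `hA` is the REGISTERED XL stub
VERBATIM (the strict-Selmer Euler-system bound at `2`: for a generator `P₀` of exact `2`-adic level `n`,
`ord₂ #Sel_str(W)[2^∞] ≤ n + ord₂ 𝔮(W, K, P, c, k, Wd, u)` — Kolyvagin's method at `p = 2` with the CM
`2`-adic image; OPEN, no theorem in print), so modulo `PublishedFactsTwo` and the `2`-torsion lemma the
crux's open content is EXACTLY that stub. Proof: obtain the witness, apply `hA`, `linarith` with the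
index identity. [cite: Kolyvagin1990, Thm. A] [cite: HuShuYin2019, Thm. 1.3 (p. 3)]
[cite: GreenbergLNM1716, §2 (pp. 62–63)] -/
theorem heegnerIndexUpperAtTwoHSY_of_strictSelmerUpper (hHSY : thm14_threePart_product)
    (h2 : ∀ (p : ℕ), p.Prime → (p % 9 = 4 ∨ p % 9 = 7) → (¬ ∃ x : ZMod p, x ^ 3 = 3) →
      ∀ (W : WeierstrassCurve ℚ) [W.IsElliptic] [W.IsGloballyMinimal],
        (∃ C : VariableChange ℚ, C • W = cubeSumCurve (p : ℚ)) →
          ∀ Q : (W.baseChange ℚ_[2]).toAffine.Point, 2 • Q = 0 → Q = 0)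
    (hA : ∀ (p : ℕ), p.Prime → (p % 9 = 4 ∨ p % 9 = 7) → (¬ ∃ x : ZMod p, x ^ 3 = 3) → ∀ (W : WeierstrassCurve ℚ) [W.IsElliptic] [W.IsGloballyMinimal], (∃ C : WeierstrassCurve.VariableChange ℚ, C • W = Literature.NumberTheory.EllipticCurves.HuShuYin2019.cubeSumCurve (p : ℚ)) → ∀ (N : ℕ) [NeZero N] (K : Type) [Field K] [NumberField K] (Dt : Literature.NumberTheory.EllipticCurves.ModularForms.ModularParametrizationData W N) (H : Literature.NumberTheory.EllipticCurves.HeegnerDatum N (NumberField.discr K)) (ι : K →+* ℂ) (P : (W.baseChange K).toAffine.Point) (Wd : WeierstrassCurve ℚ) [Wd.IsElliptic] [Wd.IsGloballyMinimal] (Cd : WeierstrassCurve.VariableChange ℚ) (k : ℕ), W.HasCM → W.analyticRank = 1 → Literature.NumberTheory.EllipticCurves.IsImaginaryQuadratic K → Literature.NumberTheory.EllipticCurves.SatisfiesHeegnerHypothesis N K → WeierstrassCurve.Affine.Point.map ι.toRatAlgHom P = Literature.NumberTheory.EllipticCurves.ModularForms.heegnerPointComplex Dt H → (W.quadraticTwist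 (NumberField.discr K : ℚ)).entireLFunction 1 ≠ 0 → Cd • W.quadraticTwist (NumberField.discr K : ℚ) = Wd → (k = 1 ∨ k = 2) → (k = 2 ↔ ∀ y : W.toAffine.Point, ∃ Q : (W.baseChange K).toAffine.Point, WeierstrassCurve.QuadraticDescent.incl K W y - (2 : ℤ) • Q ∈ AddCommGroup.torsion (W.baseChange K).toAffine.Point) → ∀ (P₀ : W.toAffine.Point) (n : ℕ), ¬ IsOfFinAddOrder P₀ → (∀ R : W.toAffine.Point, ∃ (m : ℤ) (T : W.toAffine.Point), IsOfFinAddOrder T ∧ R = m • P₀ + T) → (∀ Q : (W.baseChange ℚ_[2]).toAffine.Point, 2 • Q = 0 → Q = 0) → (∃ Q : (W.baseChange ℚ_[2]).toAffine.Point, 2 ^ n • Q = W.toPadicPoint 2 P₀) → (∀ Q : (W.baseChange ℚ_[2]).toAffine.Point, 2 ^ (n + 1) • Q ≠ W.toPadicPoint 2 P₀) → (padicValNat 2 (Nat.card ↥(Summit.BirchSwinnertonDyer.Rank1Residual.Additive.strictSelmerPInfty W 2)) : ℤ) ≤ (n : ℤ) + padicValRat 2 (Summit.BirchSwinnertonDyer.Rank1Residual.P2.cmHeegnerIndexQuotient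 W K P Dt.c k Wd Cd.u)) :
    HeegnerIndexUpperAtTwoHSY := by
  intro p hp h9 h3 W _ _ hW N _ K _ _ Dt H ι P Wd _ _ Cd k hcm hr hK hHN hP hLt hWd hk12 hkiff
  obtain ⟨P₀, n, h1, h2', h3', h4, h5, h6⟩ := stub_shaLeStrictSelmerAtTwo_of_thm14 hHSY h2 p hp h9 h3
    W hW N K Dt H ι P Wd Cd k hcm hr hK hHN hP hLt hWd hk12 hkiff
  have h7 := hA p hp h9 h3 W hW N K Dt H ι P Wd Cd k hcm hr hK hHN hP hLt hWd hk12 hkiff P₀ n h1 h2'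
    h3' h4 h5
  linarith

end Summit.BirchSwinnertonDyer.BirchSwinnertonDyer.Theorems.SylvesterTwoUpper

end
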